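import Literature.MathematicalPhysics.QuantumFieldTheory.Balaban1983to89.B4Thm19ZeroBoxHolderRateUnif
import Literature.MathematicalPhysics.QuantumFieldTheory.Balaban1983to89.B6Prop22HolderTwoLevelBox

/-!
# `Balaban1983to89.B6Prop22HolderTwoLevelBoxRateUnif` — [B6] Proposition 2.2 (2.67), ENTRY 4 `‖ζ∇G′λ‖_α` for the
# GENUINE two-level operator on a box of `L`-blocks, WITH THE PRINTED QUANTIFIER ORDER: ONE rate `δ` and ONE threshold
# «M sufficiently large» for ALL Hölder exponents `0 ≤ α < 1`, an `α`-dependent constant — p21's chain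
# `B6Ineq243HolderTwoLevelBox.ineq243_twoLevel_holder_wsum2 → B6Prop22HolderTwoLevelBox.wsum2_gZero_holder_le →
# prop22_entry4_twoLevelBox` RE-THREADED on top of `…B4Thm19ZeroBoxHolderRateUnif` (`_unif` twins; proofs = the originals
# with the `∃`-witnesses reordered)

statement-level skeleton of published theorems with citation tags; proofs where landed; nothing here is a claim about the Yang–Mills mass gap

T. Bałaban, *Propagators and renormalization transformations for lattice gauge theories. II*, Commun. Math. Phys. **96**
(1984) 223–250 [Balaban1984PropagatorsII]; [3] = *Regularity and decay of lattice Green's functions*, Commun. Math. Phys.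
**89** (1983) 571–597 [Balaban1983RegularityDecay].  PDF held `paper:balaban1984-cmp96-propagators-rt-ii` (journal page =
PDF page + 222): p. 230 [PDF 8] ((2.38), (2.43)), p. 234 [PDF 12] ((2.64)–(2.67), Prop. 2.2); [3] p. 573 [PDF 3].

CITATION HEADER (lean-in-tree rule).  Cell `lit-balaban` (HOME `run/shared/lean/pub/lit-balaban/`), unit `lit-balaban-r03`
gen 13 (B6 fold owner, row **B6.Prop2.2**; p21 successor notified — free-target protocol G.5-34(d)).  File 4 of the `_unif`
re-threading (files 1–3: `…B4Lemma24HolderRateUnif`, `…B4Thm19ZeroBoxHolderRateUnif`, `…B4Thm19ZeroBoxHolderDualRateUnif`).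
A NEW LEAF on p21's `…B6Ineq243HolderTwoLevelBox` / `…B6Prop22HolderTwoLevelBox` (gens 8–9; their `gTwoLevel`,
`wsum2_vecMul_le`, `row_dd_add_smul_mul`, `gTwoLevel_holder_wsum2_le`, `wsum2_gZero_holder_near`, `wsum_longDiff_le`,
`abs_hq_dd_le`, `exists_emb_eq_of_near`, `roww_rOp_le`, `wsum_gZero_deriv_le`, the (2.43)-inputs `ineq243_twoLevel_roww` /
`ineq243_twoLevel_deriv_wsum` … are consumed BY NAME; two PRIVATE plumbing lemmas (`wsum_le_mul_of_abs_le`, `wsum2_congr`)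
are not importable and are COPIED verbatim as private lemmas); NOTHING existing is modified.  THEOREMS ONLY.

WHAT IS PRINTED.  p. 234, Prop. 2.2: «… ‖ζ∇G′λ‖_α … ≤ O(1) … (L^jη)^{1−α}(‖ζ‖_α + |ζ|) … e^{−½δ₀d(y,y′)}|λ|» with «δ₀»
not depending on `α` (the census typing `B6.Prop22Printed`: `∃ M₁ δ₀ C, ∃ Cα : ℝ → ℝ, … ∀ α`); [3] p. 573 for the input
(1.9): «δ₀, c₀, R₀ … depending on d, M only, c₀ on α also».

WHY / WHAT.  p21's entry-4 theorems are stated `∀ α ∃ (δ, M₀, C)` because their [3]-input `thm19_zero_box_holder_roww_coeff`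
is; with `…B4Thm19ZeroBoxHolderRateUnif.thm19_zero_box_holder_roww_coeff_unif` the same proofs give print's order:
* §1 `ineq243_twoLevel_holder_wsum2_unif` — the (2.43) Hölder cube input, `∃ δ′ ∀ α ∃ c′(α)`;
* §2 `wsum2_gZero_holder_le_unif` — the parametrix `G′₀`, `∃ δ₃ ∀ α ∃ C₀(α)`; **`prop22_entry4_twoLevelBox_unif`** —
  (2.67)₄ for `G′ = gTwoLevel`: `∃ δ M₀ ∀ α ∈ [0,1) ∃ C(α)` (the threshold `M₀ = 2C_R` comes from the `α`-free `roww_rOp_le`).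
HONEST SCOPE.  Exactly that of p21's originals (two levels, Neumann box of `L`-blocks, `A = 0`, windows for `a_j`, `m²`,
`a`; `δ`, `M₀` depend on `(d, L, windows)`, `C` on these and `α`).  No new estimate — a change of quantifier order
justified by the existing proofs.  NOT summit progress.
-/

namespace Literature.MathematicalPhysics.QuantumFieldTheory.Balaban1983to89.B6Prop22HolderTwoLevelBoxRateUnif

noncomputable section

variable {d : ℕ}

/-! ## §1 The (2.43) Hölder cube input with one rate for all `α` -/

section CubeInput

open Finset Matrix
open Literature.MathematicalPhysics.QuantumFieldTheory.Balaban1983to89.B4ContourShift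
open Literature.MathematicalPhysics.QuantumFieldTheory.Balaban1983to89.B4Reflection242
open Literature.MathematicalPhysics.QuantumFieldTheory.Balaban1983to89.B4Green242Bridge
open Literature.MathematicalPhysics.QuantumFieldTheory.Balaban1983to89.B4BoxCov237
open Literature.MathematicalPhysics.QuantumFieldTheory.Balaban1983to89.B4Thm110ZeroBox
open Literature.MathematicalPhysics.QuantumFieldTheory.Balaban1983to89.B4Thm110ZeroBoxDeriv
open Literature.MathematicalPhysics.QuantumFieldTheory.Balaban1983to89.B4Thm19ZeroBoxHolder
open Literature.MathematicalPhysics.QuantumFieldTheory.Balaban1983to89.B6Ineq243TwoLevelBox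
open B4Sect5Proof (latticeConst latticeConst_nonneg)
open Literature.MathematicalPhysics.QuantumFieldTheory.Balaban1983to89.B6Ineq243HolderTwoLevelBox
open Literature.MathematicalPhysics.QuantumFieldTheory.Balaban1983to89.B4Thm19ZeroBoxHolderRateUnif

/-- **(2.43) HÖLDER-WEIGHTED CUBE INPUT FOR THE TWO-LEVEL BOX, RATE UNIFORM IN `α`** — p21's `B6Ineq243HolderTwoLevelBox.ineq243_twoLevel_holder_wsum2` in print's quantifier order `∃ δ′ ∀ α ∈ [0,1) ∃ c′(α)`: the two-centre weighted row bound of the doubly differenced kernel of `G_□ = (Δ^{ξ,N}_□ + a_jQ′*Q′ + L^{−2}aQ″*1_ΛQ″)⁻¹` on every cube; the `α`-dependent input is now `…B4Thm19ZeroBoxHolderRateUnif.thm19_zero_box_holder_roww_coeff_unif`, the other two (`thm110_zero_box_roww_coeff`, `cov116_box_finset_decay`) are `α`-free. Proof = the original with the `∃`-witnesses reordered. [cite: Balaban1984PropagatorsII, (2.43) p.230, Prop. 2.2 (2.67) p.234 (entry 4); Balaban1983RegularityDecay, Thm (1.9) p.573] -/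
theorem ineq243_twoLevel_holder_wsum2_unif (d ℓ : ℕ) (hℓ : 1 ≤ ℓ) (aminus aplus m2plus a2minus a2plus : ℝ)
    (ha : 0 < aminus) (ha2 : 0 < a2minus) :
    ∃ δ' : ℝ, 0 < δ' ∧ ∀ (α : ℝ), 0 ≤ α → α < 1 → ∃ c' : ℝ, 0 < c' ∧ ∀ (k : ℕ), 1 ≤ k → ∀ (aj m2 a : ℝ), aminus ≤ aj → aj ≤ aplus → 0 ≤ m2 →
      m2 ≤ m2plus → a2minus ≤ a → a ≤ a2plus → ∀ (M' : Fin (d + 1) → ℕ), (∀ i, 1 ≤ M' i) →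
        ∀ (Λ : Finset ↥(boxDom (fun i => (ℓ + 1) * M' i))) (μ : Fin (d + 1))
          (x xe x' xe' : ↥(boxDom (fun i => (ℓ + 1) ^ k * ((ℓ + 1) * M' i)))),
          xe.1 = x.1 + Pi.single μ 1 → xe'.1 = x'.1 + Pi.single μ 1 → x'.1 ≠ x.1 →
          ∑ z, |((((ℓ + 1) ^ k : ℕ) : ℝ) / supNorm (x'.1 - x.1)) ^ α * ((((ℓ + 1) ^ k : ℕ) : ℝ)
                * ((gTwoLevel ((ℓ + 1) ^ k) ℓ aj a m2 M' Λ xe' z - gTwoLevel ((ℓ + 1) ^ k) ℓ aj a m2 M' Λ x' z)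
                  - (gTwoLevel ((ℓ + 1) ^ k) ℓ aj a m2 M' Λ xe z - gTwoLevel ((ℓ + 1) ^ k) ℓ aj a m2 M' Λ x z)))|
              * Real.exp (δ' * min (supNorm (x.1 - z.1)) (supNorm (x'.1 - z.1)) / (((ℓ + 1) ^ k : ℕ) : ℝ))
            ≤ c' := by
  obtain ⟨δ₀, c₀, hδ₀, hc₀, hG⟩ := thm110_zero_box_roww_coeff d ℓ hℓ aminus aplus m2plus ha
  obtain ⟨δ₁, hδ₁, hGHA⟩ := thm19_zero_box_holder_roww_coeff_unif d ℓ hℓ aminus aplus m2plus ha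
  obtain ⟨δ, c, hδ, hc, hC⟩ := cov116_box_finset_decay d ℓ hℓ aminus aplus m2plus a2minus a2plus ha ha2
  have hδ'pos : 0 < min (min δ₀ δ₁) (δ / 2) := lt_min (lt_min hδ₀ hδ₁) (half_pos hδ)
  have hKn : 0 ≤ latticeConst (d + 1) (δ / 2) := latticeConst_nonneg (d + 1) (half_pos hδ).le
  refine ⟨min (min δ₀ δ₁) (δ / 2), hδ'pos, fun α hα0 hα1 => ?_⟩
  obtain ⟨c₁, hc₁, hGH⟩ := hGHA α hα0 hα1
  refine ⟨c₁ + aplus ^ 2 * (c₁ * (c * Real.exp (min (min δ₀ δ₁) (δ / 2)) * latticeConst (d + 1) (δ / 2)) * c₀),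
    by positivity, ?_⟩
  intro k hk aj m2 a h1 h2 h3 h4 h5 h6 M' hM Λ μ x xe x' xe' hxe hxe' hne
  have hn1 : 1 ≤ (ℓ + 1) ^ k := Nat.one_le_pow _ _ (by omega)
  have hMℓ : ∀ i, 1 ≤ (ℓ + 1) * M' i := fun i => by nlinarith [hM i]
  have haj : 0 < aj := lt_of_lt_of_le ha h1
  have hGz : ∀ z, roww δ₀ ((ℓ + 1) ^ k) (boxOpR ((ℓ + 1) ^ k) aj m2 (fun i => (ℓ + 1) * M' i))⁻¹ z ≤ c₀ :=
    fun z => hG k hk aj m2 h1 h2 h3 h4 (fun i => (ℓ + 1) * M' i) hMℓ z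
  have hGHx : wsum2 δ₁ ((ℓ + 1) ^ k) x x' (fun z => ((((ℓ + 1) ^ k : ℕ) : ℝ) / supNorm (x'.1 - x.1)) ^ α
      * (((((ℓ + 1) ^ k : ℕ)) : ℝ) * (((boxOpR ((ℓ + 1) ^ k) aj m2 (fun i => (ℓ + 1) * M' i))⁻¹ xe' z
        - (boxOpR ((ℓ + 1) ^ k) aj m2 (fun i => (ℓ + 1) * M' i))⁻¹ x' z)
        - ((boxOpR ((ℓ + 1) ^ k) aj m2 (fun i => (ℓ + 1) * M' i))⁻¹ xe z
        - (boxOpR ((ℓ + 1) ^ k) aj m2 (fun i => (ℓ + 1) * M' i))⁻¹ x z)))) ≤ c₁ :=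
    hGH k hk aj m2 h1 h2 h3 h4 (fun i => (ℓ + 1) * M' i) hMℓ μ x xe x' xe' hxe hxe' hne
  have hCz := (hC ((ℓ + 1) ^ k) hn1 aj m2 a h1 h2 h3 h4 h5 h6 M' hM Λ).2
  have hmain := gTwoLevel_holder_wsum2_le hn1 aj a m2 Λ hc₀.le hc.le hδ hδ'pos.le
    ((min_le_left _ _).trans (min_le_left _ _)) ((min_le_left _ _).trans (min_le_right _ _))
    (min_le_right _ _) hGz hCz _ x xe x' xe' hGHx
  rw [wsum2] at hmain
  refine hmain.trans ?_
  have : aj ^ 2 ≤ aplus ^ 2 := pow_le_pow_left₀ haj.le h2 2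
  have h0 : 0 ≤ c₁ * (c * Real.exp (min (min δ₀ δ₁) (δ / 2)) * latticeConst (d + 1) (δ / 2)) * c₀ := by
    positivity
  nlinarith

end CubeInput

/-! ## §2 The parametrix and the fixed point: entry 4 with one rate and one threshold for all `α` -/

section Entry4

open Finset Matrix
open scoped ContDiff
open Literature.MathematicalPhysics.QuantumFieldTheory.Balaban1983to89.B4Reflection242 (boxDom mem_boxDom nbrs mem_nbrs)
open Literature.MathematicalPhysics.QuantumFieldTheory.Balaban1983to89.B4ContourShift (supNorm supNorm_nonneg
  abs_le_supNorm exists_supNorm_eq)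
open Literature.MathematicalPhysics.QuantumFieldTheory.Balaban1983to89.B4Lemma22ReduceZero (Box)
open Literature.MathematicalPhysics.QuantumFieldTheory.Balaban1983to89.B4Thm110ZeroBox (roww roww_nonneg roww_add_le
  supNorm_sub_le_sub_add_sub)
open Literature.MathematicalPhysics.QuantumFieldTheory.Balaban1983to89.B4Thm110ZeroBoxDeriv (wsum wsum_nonneg wsum_add_le
  wsum_mul_left supNorm_single_le)
open Literature.MathematicalPhysics.QuantumFieldTheory.Balaban1983to89.B4Thm19ZeroBoxHolder (wsum2 wsum2_nonneg
  wsum2_add_le wsum2_mul_left wsum2_le_wsum_left wsum2_le_wsum_right wsum2_split_le wsum2_mono_rate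
  abs_sum_mul_le_of_wsum2 mulVec_dd rpow_le_self_of_one_le)
open Literature.MathematicalPhysics.QuantumFieldTheory.Balaban1983to89.B4PartitionUnity22 (hprof hCube D1 D2 D1_nonneg
  D2_nonneg contDiff_hprof hasCompactSupport_hprof hprof_nonneg hprof_le_one abs_sub_le_D1 abs_deriv2_le_D2)
open Literature.MathematicalPhysics.QuantumFieldTheory.Balaban1983to89.B4SubBoxCarrier (inSub inSub_iff)
open Literature.MathematicalPhysics.QuantumFieldTheory.Balaban1983to89.B6Ineq243TwoLevelBox
open Literature.MathematicalPhysics.QuantumFieldTheory.Balaban1983to89.B6Partition236TwoLevelBox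
open Literature.MathematicalPhysics.QuantumFieldTheory.Balaban1983to89.B6Eq238TwoLevelBox
open Literature.MathematicalPhysics.QuantumFieldTheory.Balaban1983to89.B6Ineq249TwoLevelBox
open Literature.MathematicalPhysics.QuantumFieldTheory.Balaban1983to89.B6Prop22TwoLevelBox
open Literature.MathematicalPhysics.QuantumFieldTheory.Balaban1983to89.B6Prop22DerivTwoLevelBox
open Literature.MathematicalPhysics.QuantumFieldTheory.Balaban1983to89.B6Ineq243HolderTwoLevelBox
open Literature.MathematicalPhysics.QuantumFieldTheory.Balaban1983to89.B6Prop22HolderTwoLevelBox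

variable {N : Fin (d + 1) → ℕ} in
/-- comparison: `|g| ≤ c|g′|` pointwise gives `wsum(g) ≤ c·wsum(g′)`. [folklore] -/
private theorem wsum_le_mul_of_abs_le (δ : ℝ) (n : ℕ) (x : ↥(boxDom N)) {g g' : ↥(boxDom N) → ℝ} {c : ℝ}
    (h : ∀ z, |g z| ≤ c * |g' z|) : wsum δ n x g ≤ c * wsum δ n x g' := by
  unfold wsum
  rw [Finset.mul_sum]
  refine Finset.sum_le_sum fun z _ => ?_
  rw [← mul_assoc]
  exact mul_le_mul_of_nonneg_right (h z) (Real.exp_pos _).le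

variable {N : Fin (d + 1) → ℕ} in
/-- `wsum2` depends only on the function. [folklore] -/
private theorem wsum2_congr (δ : ℝ) (n : ℕ) (x x' : ↥(boxDom N)) {g g' : ↥(boxDom N) → ℝ}
    (h : ∀ z, g z = g' z) : wsum2 δ n x x' g = wsum2 δ n x x' g' := by
  unfold wsum2
  exact Finset.sum_congr rfl fun z _ => by rw [h z]

/-- **THE ENTRY-4 HÖLDER BOUND FOR THE PARAMETRIX `G′₀ = Σ_□ h_□G_□h_□`, RATE UNIFORM IN `α`** — p21's `B6Prop22HolderTwoLevelBox.wsum2_gZero_holder_le` in the order `∃ δ₃ ∀ α ∃ C₀(α)` (rate `δ₃ = min(δa, δb, δH, δ₂)` with `δH` from `ineq243_twoLevel_holder_wsum2_unif`, all `α`-free). Proof = the original with the `∃`-witnesses reordered. [cite: Balaban1984PropagatorsII, (2.38) p.230, (2.64)–(2.66) p.234, Prop. 2.2 (2.67) p.234 (entry 4)] -/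
theorem wsum2_gZero_holder_le_unif (d ℓ : ℕ) (hℓ : 1 ≤ ℓ) (aminus aplus m2plus a2minus a2plus : ℝ) (ha : 0 < aminus)
    (ha2 : 0 < a2minus) :
    ∃ δ₃ : ℝ, 0 < δ₃ ∧ ∀ (α : ℝ), 0 ≤ α → α < 1 → ∃ C₀ : ℝ, 0 < C₀ ∧ ∀ (k : ℕ), 1 ≤ k → ∀ (aj m2 a : ℝ), aminus ≤ aj → aj ≤ aplus → 0 ≤ m2 →
      m2 ≤ m2plus → a2minus ≤ a → a ≤ a2plus → ∀ (Mh : ℕ), 3 ≤ Mh → ∀ (P : Fin (d + 1) → ℕ) (hP : ∀ i, 1 ≤ P i)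
        (Λ : Finset ↥(boxDom (fun i => (ℓ + 1) * (Mh * P i)))) (μ : Fin (d + 1))
        (x xe x' xe' : ↥(Box d ℓ k (fun i => (ℓ + 1) * (Mh * P i)))),
        xe.1 = x.1 + Pi.single μ 1 → xe'.1 = x'.1 + Pi.single μ 1 → x'.1 ≠ x.1 →
          wsum2 δ₃ ((ℓ + 1) ^ k) x x' (fun z => ((((ℓ + 1) ^ k : ℕ) : ℝ) / supNorm (x'.1 - x.1)) ^ α
              * ((((ℓ + 1) ^ k : ℕ) : ℝ)
                * ((B6Eq250.gZero (hDiag ℓ k Mh P) (gPad ℓ k Mh P aj a m2 Λ hP) xe' z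
                    - B6Eq250.gZero (hDiag ℓ k Mh P) (gPad ℓ k Mh P aj a m2 Λ hP) x' z)
                  - (B6Eq250.gZero (hDiag ℓ k Mh P) (gPad ℓ k Mh P aj a m2 Λ hP) xe z
                    - B6Eq250.gZero (hDiag ℓ k Mh P) (gPad ℓ k Mh P aj a m2 Λ hP) x z)))) ≤ C₀ := by
  obtain ⟨δa, c', hδa, hc', h243⟩ := ineq243_twoLevel_roww d ℓ hℓ aminus aplus m2plus a2minus a2plus ha ha2
  obtain ⟨δb, cd, hδb, hcd, h243d⟩ := ineq243_twoLevel_deriv_wsum d ℓ hℓ aminus aplus m2plus a2minus a2plus ha ha2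
  obtain ⟨δH, hδH, hHA⟩ :=
    ineq243_twoLevel_holder_wsum2_unif d ℓ hℓ aminus aplus m2plus a2minus a2plus ha ha2
  obtain ⟨δ₂, C₂, hδ₂, hC₂, hG0⟩ := wsum_gZero_deriv_le d ℓ hℓ aminus aplus m2plus a2minus a2plus ha ha2
  have hD1 := D1_nonneg contDiff_hprof hasCompactSupport_hprof
  have hD2 := D2_nonneg contDiff_hprof hasCompactSupport_hprof
  obtain ⟨δ₃, hδ₃⟩ : ∃ δ : ℝ, δ = min (min δa δb) (min δH δ₂) := ⟨_, rfl⟩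
  have hδ₃0 : 0 < δ₃ := by rw [hδ₃]; exact lt_min (lt_min hδa hδb) (lt_min hδH hδ₂)
  have hδ₃a : δ₃ ≤ δa := by rw [hδ₃]; exact (min_le_left _ _).trans (min_le_left _ _)
  have hδ₃b : δ₃ ≤ δb := by rw [hδ₃]; exact (min_le_left _ _).trans (min_le_right _ _)
  have hδ₃H : δ₃ ≤ δH := by rw [hδ₃]; exact (min_le_right _ _).trans (min_le_left _ _)
  have hδ₃2 : δ₃ ≤ δ₂ := by rw [hδ₃]; exact (min_le_right _ _).trans (min_le_right _ _)
  refine ⟨δ₃, hδ₃0, fun α hα0 hα1 => ?_⟩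
  obtain ⟨cH, hcH, hH⟩ := hHA α hα0 hα1
  obtain ⟨B, hB⟩ : ∃ B : ℝ, B = (D2 hprof + d * D1 hprof ^ 2) * (Real.exp δ₃ * c') + (d + 1) * D1 hprof * cd
      + (d + 1) * D1 hprof * (Real.exp δ₃ * ((d + 1) * (Real.exp δ₃ * cd))) + cH := ⟨_, rfl⟩
  have hB0 : 0 ≤ B := by rw [hB]; positivity
  refine ⟨4 * 2 ^ (d + 1) * B + 2 * C₂, by positivity, ?_⟩
  intro k hk aj m2 a e1 e2 e3 e4 e5 e6 Mh hMh P hP Λ μ x xe x' xe' hxe hxe' hne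
  have hMh1 : 1 ≤ Mh := le_trans (by norm_num) hMh
  have hn1 : 1 ≤ (ℓ + 1) ^ k := Nat.one_le_pow _ _ (by omega)
  have hnr : (0 : ℝ) < (((ℓ + 1) ^ k : ℕ) : ℝ) := by exact_mod_cast hn1
  have hM' : ∀ q : ↥(ctrs P), ∀ i, 1 ≤ cubeM' Mh P q.1 i := fun q i =>
    Nat.one_le_iff_ne_zero.2 (Nat.mul_ne_zero_iff.2 ⟨by omega, by have := (one_le_cubeW hP q.2 i).1; omega⟩)
  have hs0 : 0 < supNorm (x'.1 - x.1) :=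
    lt_of_lt_of_le one_pos (B4StripSumsHolder.one_le_supNorm (sub_ne_zero.2 hne))
  have hWt0 : 0 ≤ ((((ℓ + 1) ^ k : ℕ) : ℝ) / supNorm (x'.1 - x.1)) ^ α :=
    Real.rpow_nonneg (div_nonneg hnr.le hs0.le) α
  have hpos : 0 ≤ 4 * 2 ^ (d + 1) * B := by positivity
  by_cases hfar : (((ℓ + 1) ^ k : ℕ) : ℝ) ≤ supNorm (x'.1 - x.1)
  · -- FAR PAIRS: the Hölder weight is `≤ 1`
    have hWt1 : ((((ℓ + 1) ^ k : ℕ) : ℝ) / supNorm (x'.1 - x.1)) ^ α ≤ 1 :=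
      Real.rpow_le_one (div_nonneg hnr.le hs0.le) ((div_le_one hs0).2 hfar) hα0
    have hsplit : ∀ z, (((ℓ + 1) ^ k : ℕ) : ℝ)
        * ((B6Eq250.gZero (hDiag ℓ k Mh P) (gPad ℓ k Mh P aj a m2 Λ hP) xe' z
            - B6Eq250.gZero (hDiag ℓ k Mh P) (gPad ℓ k Mh P aj a m2 Λ hP) x' z)
          - (B6Eq250.gZero (hDiag ℓ k Mh P) (gPad ℓ k Mh P aj a m2 Λ hP) xe z
            - B6Eq250.gZero (hDiag ℓ k Mh P) (gPad ℓ k Mh P aj a m2 Λ hP) x z))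
        = -((((ℓ + 1) ^ k : ℕ) : ℝ) * (B6Eq250.gZero (hDiag ℓ k Mh P) (gPad ℓ k Mh P aj a m2 Λ hP) xe z
            - B6Eq250.gZero (hDiag ℓ k Mh P) (gPad ℓ k Mh P aj a m2 Λ hP) x z))
          + (((ℓ + 1) ^ k : ℕ) : ℝ) * (B6Eq250.gZero (hDiag ℓ k Mh P) (gPad ℓ k Mh P aj a m2 Λ hP) xe' z
            - B6Eq250.gZero (hDiag ℓ k Mh P) (gPad ℓ k Mh P aj a m2 Λ hP) x' z) := by
      intro z; ring
    have h1 : wsum δ₃ ((ℓ + 1) ^ k) x (fun z => -((((ℓ + 1) ^ k : ℕ) : ℝ)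
        * (B6Eq250.gZero (hDiag ℓ k Mh P) (gPad ℓ k Mh P aj a m2 Λ hP) xe z
          - B6Eq250.gZero (hDiag ℓ k Mh P) (gPad ℓ k Mh P aj a m2 Λ hP) x z))) ≤ C₂ := by
      have e := wsum_le_mul_of_abs_le δ₃ ((ℓ + 1) ^ k) x
        (g := fun z => -((((ℓ + 1) ^ k : ℕ) : ℝ)
          * (B6Eq250.gZero (hDiag ℓ k Mh P) (gPad ℓ k Mh P aj a m2 Λ hP) xe z
            - B6Eq250.gZero (hDiag ℓ k Mh P) (gPad ℓ k Mh P aj a m2 Λ hP) x z)))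
        (g' := fun z => (((ℓ + 1) ^ k : ℕ) : ℝ)
          * (B6Eq250.gZero (hDiag ℓ k Mh P) (gPad ℓ k Mh P aj a m2 Λ hP) xe z
            - B6Eq250.gZero (hDiag ℓ k Mh P) (gPad ℓ k Mh P aj a m2 Λ hP) x z)) (c := 1)
        (fun z => by rw [abs_neg, one_mul])
      rw [one_mul] at e
      exact e.trans ((wsum_mono hδ₃2 _ _ _).trans (hG0 k hk aj m2 a e1 e2 e3 e4 e5 e6 Mh hMh1 P hP Λ μ x xe hxe))
    have h2 : wsum δ₃ ((ℓ + 1) ^ k) x' (fun z => (((ℓ + 1) ^ k : ℕ) : ℝ)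
        * (B6Eq250.gZero (hDiag ℓ k Mh P) (gPad ℓ k Mh P aj a m2 Λ hP) xe' z
          - B6Eq250.gZero (hDiag ℓ k Mh P) (gPad ℓ k Mh P aj a m2 Λ hP) x' z)) ≤ C₂ :=
      (wsum_mono hδ₃2 _ _ _).trans (hG0 k hk aj m2 a e1 e2 e3 e4 e5 e6 Mh hMh1 P hP Λ μ x' xe' hxe')
    have h3 := wsum2_split_le hδ₃0.le ((ℓ + 1) ^ k) x x' _ _ _ hsplit
    rw [wsum2_mul_left _ _ _ _ hWt0]
    have h4 : wsum2 δ₃ ((ℓ + 1) ^ k) x x' (fun z => (((ℓ + 1) ^ k : ℕ) : ℝ)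
        * ((B6Eq250.gZero (hDiag ℓ k Mh P) (gPad ℓ k Mh P aj a m2 Λ hP) xe' z
            - B6Eq250.gZero (hDiag ℓ k Mh P) (gPad ℓ k Mh P aj a m2 Λ hP) x' z)
          - (B6Eq250.gZero (hDiag ℓ k Mh P) (gPad ℓ k Mh P aj a m2 Λ hP) xe z
            - B6Eq250.gZero (hDiag ℓ k Mh P) (gPad ℓ k Mh P aj a m2 Λ hP) x z))) ≤ 2 * C₂ := by linarith
    calc ((((ℓ + 1) ^ k : ℕ) : ℝ) / supNorm (x'.1 - x.1)) ^ α * wsum2 δ₃ ((ℓ + 1) ^ k) x x'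
          (fun z => (((ℓ + 1) ^ k : ℕ) : ℝ)
            * ((B6Eq250.gZero (hDiag ℓ k Mh P) (gPad ℓ k Mh P aj a m2 Λ hP) xe' z
                - B6Eq250.gZero (hDiag ℓ k Mh P) (gPad ℓ k Mh P aj a m2 Λ hP) x' z)
              - (B6Eq250.gZero (hDiag ℓ k Mh P) (gPad ℓ k Mh P aj a m2 Λ hP) xe z
                - B6Eq250.gZero (hDiag ℓ k Mh P) (gPad ℓ k Mh P aj a m2 Λ hP) x z)))
        ≤ 1 * (2 * C₂) := mul_le_mul hWt1 h4 (wsum2_nonneg _ _ _ _ _) zero_le_one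
      _ ≤ 4 * 2 ^ (d + 1) * B + 2 * C₂ := by linarith
  · -- NEAR PAIRS
    have hsn : supNorm (x'.1 - x.1) < (((ℓ + 1) ^ k : ℕ) : ℝ) := lt_of_not_ge hfar
    have h243' : ∀ (q : ↥(ctrs P)) (b : ↥(Box d ℓ k (fun i => (ℓ + 1) * cubeM' Mh P q.1 i))),
        roww δ₃ ((ℓ + 1) ^ k) (cubeG ℓ k Mh P aj a m2 Λ hP q) b ≤ c' := fun q b =>
      (roww_mono hδ₃a _ _ _).trans
        (h243 k hk aj m2 a e1 e2 e3 e4 e5 e6 (cubeM' Mh P q.1) (hM' q) (lamLoc ℓ Mh P q.1 hP q.2 Λ) b)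
    have h243d' : ∀ (q : ↥(ctrs P)) (i : Fin (d + 1)) (u ue : ↥(Box d ℓ k (fun i => (ℓ + 1) * cubeM' Mh P q.1 i))),
        ue.1 = u.1 + Pi.single i 1 →
        wsum δ₃ ((ℓ + 1) ^ k) u (fun c => (((ℓ + 1) ^ k : ℕ) : ℝ)
          * (cubeG ℓ k Mh P aj a m2 Λ hP q ue c - cubeG ℓ k Mh P aj a m2 Λ hP q u c)) ≤ cd := by
      intro q i u ue hue
      refine (wsum_mono hδ₃b _ _ _).trans ?_
      unfold wsum cubeG
      exact h243d k hk aj m2 a e1 e2 e3 e4 e5 e6 (cubeM' Mh P q.1) (hM' q) (lamLoc ℓ Mh P q.1 hP q.2 Λ) i u ue hue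
    have hH' : ∀ (q : ↥(ctrs P)) (u ue u' ue' : ↥(Box d ℓ k (fun i => (ℓ + 1) * cubeM' Mh P q.1 i))),
        ue.1 = u.1 + Pi.single μ 1 → ue'.1 = u'.1 + Pi.single μ 1 → u'.1 ≠ u.1 →
        wsum2 δ₃ ((ℓ + 1) ^ k) u u' (fun c => ((((ℓ + 1) ^ k : ℕ) : ℝ) / supNorm (u'.1 - u.1)) ^ α
          * ((((ℓ + 1) ^ k : ℕ) : ℝ) * ((cubeG ℓ k Mh P aj a m2 Λ hP q ue' c - cubeG ℓ k Mh P aj a m2 Λ hP q u' c)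
            - (cubeG ℓ k Mh P aj a m2 Λ hP q ue c - cubeG ℓ k Mh P aj a m2 Λ hP q u c)))) ≤ cH := by
      intro q u ue u' ue' hue hue' hne'
      refine (wsum2_mono_rate hδ₃H _ _ _ _).trans ?_
      unfold wsum2 cubeG
      exact hH k hk aj m2 a e1 e2 e3 e4 e5 e6 (cubeM' Mh P q.1) (hM' q) (lamLoc ℓ Mh P q.1 hP q.2 Λ) μ u ue u' ue'
        hue hue' hne'
    have hnear := wsum2_gZero_holder_near hℓ hk hMh hP Λ hδ₃0 hc'.le hcd.le hcH.le hα1.le h243' h243d' hH'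
      hxe hxe' hne hsn
    rw [← hB] at hnear
    linarith

/-- **[B6] PROPOSITION 2.2 (2.67)₄ FOR THE GENUINE TWO-LEVEL OPERATOR ON A BOX OF `L`-BLOCKS, WITH THE PRINTED QUANTIFIER ORDER** — p21's `B6Prop22HolderTwoLevelBox.prop22_entry4_twoLevelBox` re-threaded: `∃ δ M₀ ∀ α ∈ [0,1) ∃ C(α)` — ONE rate and ONE threshold «M sufficiently large» (`M₀ = 2C_R` from the `α`-free `roww_rOp_le`) for all Hölder exponents; `Σ_z (n/|x′−x|_∞)^α|ξ^{−1}(((G′(x′+e_μ,z) − G′(x′,z)) − (G′(x+e_μ,z) − G′(x,z)))|e^{δmin(|x−z|,|x′−z|)/n} ≤ C(α)`. Proof = the original with the `∃`-witnesses reordered. [cite: Balaban1984PropagatorsII, Proposition 2.2 (2.67) p.234 (entry ‖ζ∇G′λ‖_α); Balaban1983RegularityDecay, Thm (1.9) p.573 («δ₀, c₀, R₀ … depending on d, M only, c₀ on α also»)] -/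
theorem prop22_entry4_twoLevelBox_unif (d ℓ : ℕ) (hℓ : 1 ≤ ℓ) (aminus aplus m2plus a2minus a2plus : ℝ) (ha : 0 < aminus)
    (ha2 : 0 < a2minus) :
    ∃ δ M₀ : ℝ, 0 < δ ∧ 0 < M₀ ∧ ∀ (α : ℝ), 0 ≤ α → α < 1 → ∃ C : ℝ, 0 < C ∧ ∀ (k : ℕ), 1 ≤ k → ∀ (aj m2 a : ℝ), aminus ≤ aj → aj ≤ aplus → 0 ≤ m2 →
      m2 ≤ m2plus → a2minus ≤ a → a ≤ a2plus → ∀ (Mh : ℕ), 3 ≤ Mh → M₀ ≤ ((ℓ : ℝ) + 1) * Mh →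
        ∀ (P : Fin (d + 1) → ℕ), (∀ i, 1 ≤ P i) → ∀ (Λ : Finset ↥(boxDom (fun i => (ℓ + 1) * (Mh * P i)))),
        IsBlockUnion ℓ (fun i => Mh * P i) Λ → ∀ (μ : Fin (d + 1))
        (x xe x' xe' : ↥(Box d ℓ k (fun i => (ℓ + 1) * (Mh * P i)))),
        xe.1 = x.1 + Pi.single μ 1 → xe'.1 = x'.1 + Pi.single μ 1 → x'.1 ≠ x.1 →
          wsum2 δ ((ℓ + 1) ^ k) x x' (fun z => ((((ℓ + 1) ^ k : ℕ) : ℝ) / supNorm (x'.1 - x.1)) ^ α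
              * ((((ℓ + 1) ^ k : ℕ) : ℝ)
                * ((gTwoLevel ((ℓ + 1) ^ k) ℓ aj a m2 (fun i => Mh * P i) Λ xe' z
                    - gTwoLevel ((ℓ + 1) ^ k) ℓ aj a m2 (fun i => Mh * P i) Λ x' z)
                  - (gTwoLevel ((ℓ + 1) ^ k) ℓ aj a m2 (fun i => Mh * P i) Λ xe z
                    - gTwoLevel ((ℓ + 1) ^ k) ℓ aj a m2 (fun i => Mh * P i) Λ x z)))) ≤ C := by
  obtain ⟨δ₁, CR, hδ₁, hCR, hR⟩ := roww_rOp_le d ℓ hℓ aminus aplus m2plus a2minus a2plus ha ha2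
  obtain ⟨δ₃, hδ₃, hG0A⟩ :=
    wsum2_gZero_holder_le_unif d ℓ hℓ aminus aplus m2plus a2minus a2plus ha ha2
  refine ⟨min δ₁ δ₃, 2 * CR, lt_min hδ₁ hδ₃, by positivity, fun α hα0 hα1 => ?_⟩
  obtain ⟨C₀, hC₀, hG0⟩ := hG0A α hα0 hα1
  refine ⟨2 * C₀, by positivity, ?_⟩
  intro k hk aj m2 a e1 e2 e3 e4 e5 e6 Mh hMh hM P hP Λ hΛ μ x xe x' xe' hxe hxe' hne
  have hMh1 : 1 ≤ Mh := le_trans (by norm_num) hMh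
  have hδ0 : 0 ≤ min δ₁ δ₃ := (lt_min hδ₁ hδ₃).le
  have hMpos : (0 : ℝ) < ((ℓ : ℝ) + 1) * Mh := by
    have : (3 : ℝ) ≤ Mh := by exact_mod_cast hMh
    have : (0 : ℝ) ≤ ℓ := Nat.cast_nonneg ℓ
    positivity
  set n : ℕ := (ℓ + 1) ^ k with hn
  set G := gTwoLevel ((ℓ + 1) ^ k) ℓ aj a m2 (fun i => Mh * P i) Λ with hG
  set G₀ := B6Eq250.gZero (hDiag ℓ k Mh P) (gPad ℓ k Mh P aj a m2 Λ hP) with hG₀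
  set Rm := B6Eq250.rOp (twoLevelOp ((ℓ + 1) ^ k) ℓ aj a m2 (fun i => Mh * P i) Λ) (hDiag ℓ k Mh P)
    (gPad ℓ k Mh P aj a m2 Λ hP) with hRm
  have hRrow : ∀ y, roww (min δ₁ δ₃) n Rm y ≤ 1 / 2 := by
    intro y
    refine (roww_mono (min_le_left _ _) _ _ _).trans ((hR k hk aj m2 a e1 e2 e3 e4 e5 e6 Mh hMh P hP Λ hΛ y).trans ?_)
    calc CR / (((ℓ : ℝ) + 1) * Mh) ≤ CR / (2 * CR) := div_le_div_of_nonneg_left hCR.le (by positivity) hM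
      _ = 1 / 2 := by field_simp
  have hfix : G = G₀ + G * Rm :=
    gTwoLevel_eq_gZero_add hℓ hk hMh1 hP (lt_of_lt_of_le ha e1) (lt_of_lt_of_le ha2 e5) e3 hΛ
  set W : ℝ := (((n : ℕ) : ℝ) / supNorm (x'.1 - x.1)) ^ α with hW
  -- the doubly differenced fixed point, entrywise
  have hent : ∀ z, W * ((n : ℝ) * ((G xe' z - G x' z) - (G xe z - G x z)))
      = W * ((n : ℝ) * ((G₀ xe' z - G₀ x' z) - (G₀ xe z - G₀ x z)))
        + ∑ y, (W * ((n : ℝ) * ((G xe' y - G x' y) - (G xe y - G x y)))) * Rm y z := by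
    intro z
    have e : ∀ y, G y z = G₀ y z + ∑ y', G y y' * Rm y' z := by
      intro y
      conv_lhs => rw [hfix]
      rw [Matrix.add_apply, Matrix.mul_apply]
    rw [e xe', e x', e xe, e x]
    have : ∑ y, (W * ((n : ℝ) * ((G xe' y - G x' y) - (G xe y - G x y)))) * Rm y z
        = W * ((n : ℝ) * ((∑ y, G xe' y * Rm y z - ∑ y, G x' y * Rm y z)
          - (∑ y, G xe y * Rm y z - ∑ y, G x y * Rm y z))) := by
      rw [← Finset.sum_sub_distrib, ← Finset.sum_sub_distrib, ← Finset.sum_sub_distrib, Finset.mul_sum,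
        Finset.mul_sum]
      exact Finset.sum_congr rfl fun y _ => by ring
    rw [this]
    ring
  set V := wsum2 (min δ₁ δ₃) n x x' (fun z => W * ((n : ℝ) * ((G xe' z - G x' z) - (G xe z - G x z)))) with hV
  have hVfix : V ≤ C₀ + V * (1 / 2) := by
    calc V = wsum2 (min δ₁ δ₃) n x x' (fun z => W * ((n : ℝ) * ((G₀ xe' z - G₀ x' z) - (G₀ xe z - G₀ x z)))
          + ∑ y, (W * ((n : ℝ) * ((G xe' y - G x' y) - (G xe y - G x y)))) * Rm y z) := by
            rw [hV]; exact wsum2_congr _ _ _ _ hent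
      _ ≤ wsum2 (min δ₁ δ₃) n x x' (fun z => W * ((n : ℝ) * ((G₀ xe' z - G₀ x' z) - (G₀ xe z - G₀ x z))))
          + wsum2 (min δ₁ δ₃) n x x' (fun z =>
              ∑ y, (W * ((n : ℝ) * ((G xe' y - G x' y) - (G xe y - G x y)))) * Rm y z) :=
            wsum2_add_le _ _ _ _ _ _
      _ ≤ C₀ + V * (1 / 2) :=
            add_le_add ((wsum2_mono_rate (min_le_right _ _) _ _ _ _).trans
              (hG0 k hk aj m2 a e1 e2 e3 e4 e5 e6 Mh hMh P hP Λ μ x xe x' xe' hxe hxe' hne))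
              (wsum2_vecMul_le hδ0 n x x' _ Rm hRrow)
  have hVle : V ≤ 2 * C₀ := by linarith
  exact hVle

end Entry4

end

end Literature.MathematicalPhysics.QuantumFieldTheory.Balaban1983to89.B6Prop22HolderTwoLevelBoxRateUnif
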